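import Mathlib.Analysis.SpecialFunctions.Pow.Real
import Mathlib.Analysis.SpecialFunctions.Sqrt
import Mathlib.Algebra.Order.BigOperators.Ring.Finset
import Mathlib.Algebra.Order.Chebyshev
import HarnessLib

/-!
# The reset-invariant window recursion of the one-level step: `‖u−v‖²` and `⟨v, u−v⟩` across refresh windows (K1L_D helper)

Helper file of route `SolenoidalFractalHomogenisation`, crux K1L_D `LagrangianRenormalisationStepDesign` (stmt-AnomalousDissipation-27980), for the
planned stub `stub_windowBookkeepingL` (S3 of the tenure's split D24-6 of `stub_oneLevelL_IW`).  Companion of `…LagrangianStepWindowRecursion`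
(per-MODE recursion); this file is the per-WINDOW recursion in RESET-INVARIANT SCALARS, which is the form the window bookkeeping must take because
the Lagrangian frame is RESET at every refresh window of level `m+1` and the common frame change `x ↦ X_j(x)` (a volume-preserving map with small
strain `‖DX_j − 1‖ ≤ θ (m+1)` but displacement ≫ cell size) does NOT preserve the sector / single-mode decomposition used inside a window — it
preserves only quantities that are invariant under a common `L²`-isometry of `u` and `v`: the energies `‖u(w_j)‖²`, `‖v(w_j)‖²`, the distance
`D_j = ‖u(w_j) − v(w_j)‖²` and the correlation `C_j = ⟨v(w_j), u(w_j) − v(w_j)⟩` (`‖u‖² = ‖v‖² + 2C + D`).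

THE RECURSION (what the per-window analysis S1+S2 is to deliver, window `j ↦ j+1`, `δᵛ_j := ‖v(w_j)‖² − ‖v(w_{j+1})‖² ≥ 0` the effective
drop over the window, `δᵈ_j ≥ 0` an auxiliary "effective drop of the difference"):
  (R1) `D_{j+1} ≤ D_j − κ·δᵈ_j + ε·δᵛ_j`,
  (R2) `|C_{j+1} − C_j| ≤ A·√(δᵛ_j·δᵈ_j) + B·δᵛ_j`.
(Inside a window, in the frame's Fourier basis with effective one-window decay factors `q_ℓ ∈ [0,1]` and the decay-relative per-mode tracking law
`|û_ℓ(end) − q_ℓ û_ℓ(start)| ≤ ε₀ (1 − q_ℓ) |û_ℓ(start)|` of `…WindowRecursion`, (R1)/(R2) hold with `κ = 1 − 2ε₀ − 2ε₀²`, `ε = ε₀/2 + 2ε₀²`,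
`A = 1 + ε₀/2`, `B = ε₀/2` — § 2 proves this Hilbert-space algebra over a finite orthogonal decomposition.)

THE CONCLUSION (§ 1, pure real algebra + Cauchy–Schwarz over the windows): with `D_0 = C_0 = 0` (same datum),
  `D_J ≤ ε·drop_v`,  `Σ_{j<J} δᵈ_j ≤ (ε/κ)·drop_v`,  `|C_J| ≤ (A·√(ε/κ) + B)·drop_v`,  hence
  `‖u(w_J)‖² − ‖v(w_J)‖² ≤ (2A√(ε/κ) + 2B + ε)·drop_v`, i.e. `(1 − (2A√(ε/κ) + 2B + ε))·drop_v ≤ drop_u`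
— decay-relative with `O(√ε₀)`, WITHOUT any identification of modes across windows.

Pure real algebra; no definitions, no named facts, no sorry.  NOT a proof of the one-level comparison, of the crux, of Onsager's conjecture or of
anomalous dissipation — rung-leaf F-D1.A0 bookkeeping only.  Prover seat `ad-k3l-bookkeeping-p1` g4, 2026-08-28.
-/

set_option linter.dupNamespace false

noncomputable section

namespace Summit.AnomalousDissipation.AnomalousDissipation.Theorems.SolenoidalFractalHomogenisation.LagrangianStep

open Finset Real

/-! ## § 1. The scalar recursion across windows -/

/-- (R1) telescopes: `D_J + κ Σ_{j<J} δᵈ_j ≤ D_0 + ε (E_0 − E_J)` for `E_j = ‖v(w_j)‖²`. [folklore] -/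
theorem dist_add_sum_le_of_R1 (D E δd : ℕ → ℝ) {κ ε : ℝ}
    (hR1 : ∀ j, D (j + 1) ≤ D j - κ * δd j + ε * (E j - E (j + 1))) (J : ℕ) :
    D J + κ * ∑ j ∈ range J, δd j ≤ D 0 + ε * (E 0 - E J) := by
  induction J with
  | zero => simp
  | succ J ih =>
    rw [sum_range_succ, mul_add]
    have h := hR1 J
    linarith

/-- Hence, with `D_0 = 0`, `κ > 0`, `δᵈ ≥ 0`: the distance is decay-relative, `D_J ≤ ε (E_0 − E_J)`. [folklore] -/
theorem dist_le_of_R1 (D E δd : ℕ → ℝ) {κ ε : ℝ} (hκ : 0 < κ) (hδd : ∀ j, 0 ≤ δd j) (hD0 : D 0 = 0)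
    (hR1 : ∀ j, D (j + 1) ≤ D j - κ * δd j + ε * (E j - E (j + 1))) (J : ℕ) :
    D J ≤ ε * (E 0 - E J) := by
  have h := dist_add_sum_le_of_R1 D E δd hR1 J
  have hs : 0 ≤ κ * ∑ j ∈ range J, δd j := mul_nonneg hκ.le (sum_nonneg fun j _ => hδd j)
  linarith

/-- … and the auxiliary drops are summable against the effective drop: `Σ_{j<J} δᵈ_j ≤ (ε/κ)(E_0 − E_J)` (uses `D_J ≥ 0`). [folklore] -/
theorem sum_auxDrop_le_of_R1 (D E δd : ℕ → ℝ) {κ ε : ℝ} (hκ : 0 < κ) (hD : ∀ j, 0 ≤ D j) (hD0 : D 0 = 0)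
    (hR1 : ∀ j, D (j + 1) ≤ D j - κ * δd j + ε * (E j - E (j + 1))) (J : ℕ) :
    ∑ j ∈ range J, δd j ≤ ε / κ * (E 0 - E J) := by
  have h := dist_add_sum_le_of_R1 D E δd hR1 J
  have hDJ := hD J
  rw [div_mul_eq_mul_div, le_div_iff₀ hκ]
  linarith

/-- **Cauchy–Schwarz over the windows**: `Σ_{j<J} √(x_j y_j) ≤ √(Σ x_j) · √(Σ y_j)` for nonnegative `x, y`. [folklore] -/
theorem sum_sqrt_mul_le (x y : ℕ → ℝ) (hx : ∀ j, 0 ≤ x j) (hy : ∀ j, 0 ≤ y j) (J : ℕ) :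
    ∑ j ∈ range J, Real.sqrt (x j * y j) ≤ Real.sqrt (∑ j ∈ range J, x j) * Real.sqrt (∑ j ∈ range J, y j) := by
  have h1 : ∑ j ∈ range J, Real.sqrt (x j * y j) = ∑ j ∈ range J, Real.sqrt (x j) * Real.sqrt (y j) :=
    sum_congr rfl fun j _ => Real.sqrt_mul (hx j) (y j)
  rw [h1]
  have hcs := sum_mul_sq_le_sq_mul_sq (range J) (fun j => Real.sqrt (x j)) (fun j => Real.sqrt (y j))
  have e1 : ∑ j ∈ range J, Real.sqrt (x j) ^ 2 = ∑ j ∈ range J, x j := sum_congr rfl fun j _ => Real.sq_sqrt (hx j)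
  have e2 : ∑ j ∈ range J, Real.sqrt (y j) ^ 2 = ∑ j ∈ range J, y j := sum_congr rfl fun j _ => Real.sq_sqrt (hy j)
  rw [e1, e2] at hcs
  have hL : 0 ≤ ∑ j ∈ range J, Real.sqrt (x j) * Real.sqrt (y j) :=
    sum_nonneg fun j _ => mul_nonneg (Real.sqrt_nonneg _) (Real.sqrt_nonneg _)
  have hX : 0 ≤ ∑ j ∈ range J, x j := sum_nonneg fun j _ => hx j
  have hY : 0 ≤ ∑ j ∈ range J, y j := sum_nonneg fun j _ => hy j
  rw [← Real.sqrt_mul hX, ← Real.sqrt_sq hL]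
  exact Real.sqrt_le_sqrt hcs

/-- (R2) telescopes with Cauchy–Schwarz: `|C_J − C_0| ≤ A·√(Σδᵛ)·√(Σδᵈ) + B·Σδᵛ`. [folklore] -/
theorem abs_corr_sub_le_of_R2 (C E δd : ℕ → ℝ) {A B : ℝ} (hA : 0 ≤ A) (hE : ∀ j, E (j + 1) ≤ E j) (hδd : ∀ j, 0 ≤ δd j)
    (hR2 : ∀ j, |C (j + 1) - C j| ≤ A * Real.sqrt ((E j - E (j + 1)) * δd j) + B * (E j - E (j + 1))) (J : ℕ) :
    |C J - C 0| ≤ A * (Real.sqrt (E 0 - E J) * Real.sqrt (∑ j ∈ range J, δd j)) + B * (E 0 - E J) := by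
  have hδv : ∀ j, 0 ≤ E j - E (j + 1) := fun j => by linarith [hE j]
  -- telescoping of `C` and of `E`
  have htel : ∀ J, |C J - C 0| ≤ ∑ j ∈ range J, |C (j + 1) - C j| := by
    intro J
    induction J with
    | zero => simp
    | succ J ih =>
      rw [sum_range_succ]
      calc |C (J + 1) - C 0| = |(C (J + 1) - C J) + (C J - C 0)| := by ring_nf
        _ ≤ |C (J + 1) - C J| + |C J - C 0| := abs_add_le _ _
        _ ≤ _ := by linarith
  have hEtel : ∀ J, ∑ j ∈ range J, (E j - E (j + 1)) = E 0 - E J := by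
    intro J
    induction J with
    | zero => simp
    | succ J ih => rw [sum_range_succ, ih]; ring
  calc |C J - C 0| ≤ ∑ j ∈ range J, |C (j + 1) - C j| := htel J
    _ ≤ ∑ j ∈ range J, (A * Real.sqrt ((E j - E (j + 1)) * δd j) + B * (E j - E (j + 1))) := sum_le_sum fun j _ => hR2 j
    _ = A * ∑ j ∈ range J, Real.sqrt ((E j - E (j + 1)) * δd j) + B * ∑ j ∈ range J, (E j - E (j + 1)) := by
        rw [sum_add_distrib, mul_sum, mul_sum]
    _ ≤ A * (Real.sqrt (∑ j ∈ range J, (E j - E (j + 1))) * Real.sqrt (∑ j ∈ range J, δd j)) + B * ∑ j ∈ range J, (E j - E (j + 1)) := by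
        have := sum_sqrt_mul_le (fun j => E j - E (j + 1)) δd hδv hδd J
        linarith [mul_le_mul_of_nonneg_left this hA]
    _ = A * (Real.sqrt (E 0 - E J) * Real.sqrt (∑ j ∈ range J, δd j)) + B * (E 0 - E J) := by rw [hEtel]

/-- **The reset-invariant window recursion ⇒ decay-relative energy comparison.**  From (R1), (R2) with `D_0 = C_0 = 0`, `κ > 0`, `0 ≤ ε`,
`A ≥ 0`, `δᵈ ≥ 0`, `D ≥ 0`, `E` non-increasing, and the energy bookkeeping `‖u_J‖² = E_J + 2 C_J + D_J`:
`‖u_J‖² − E_J ≤ (2A·√(ε/κ) + 2B + ε)·(E_0 − E_J)`. [folklore] -/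
theorem energy_sub_le_of_R1_R2 (D C E Eu δd : ℕ → ℝ) {κ ε A B : ℝ} (hκ : 0 < κ) (hε : 0 ≤ ε) (hA : 0 ≤ A)
    (hD : ∀ j, 0 ≤ D j) (hD0 : D 0 = 0) (hC0 : C 0 = 0) (hE : ∀ j, E (j + 1) ≤ E j) (hδd : ∀ j, 0 ≤ δd j)
    (hR1 : ∀ j, D (j + 1) ≤ D j - κ * δd j + ε * (E j - E (j + 1)))
    (hR2 : ∀ j, |C (j + 1) - C j| ≤ A * Real.sqrt ((E j - E (j + 1)) * δd j) + B * (E j - E (j + 1)))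
    (hEu : ∀ j, Eu j = E j + 2 * C j + D j) (J : ℕ) :
    Eu J - E J ≤ (2 * A * Real.sqrt (ε / κ) + 2 * B + ε) * (E 0 - E J) := by
  have hdrop : 0 ≤ E 0 - E J := by
    have : ∀ J, E J ≤ E 0 := by
      intro J
      induction J with
      | zero => exact le_rfl
      | succ J ih => exact (hE J).trans ih
    linarith [this J]
  have h1 := dist_le_of_R1 D E δd hκ hδd hD0 hR1 J
  have h2 := sum_auxDrop_le_of_R1 D E δd hκ hD hD0 hR1 J
  have h3 := abs_corr_sub_le_of_R2 C E δd hA hE hδd hR2 J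
  rw [hC0, sub_zero] at h3
  -- `√(Σδᵈ) ≤ √(ε/κ) √(E₀ − E_J)`
  have h4 : Real.sqrt (∑ j ∈ range J, δd j) ≤ Real.sqrt (ε / κ) * Real.sqrt (E 0 - E J) := by
    rw [← Real.sqrt_mul (div_nonneg hε hκ.le)]
    exact Real.sqrt_le_sqrt h2
  have h5 : Real.sqrt (E 0 - E J) * Real.sqrt (∑ j ∈ range J, δd j) ≤ Real.sqrt (ε / κ) * (E 0 - E J) := by
    calc Real.sqrt (E 0 - E J) * Real.sqrt (∑ j ∈ range J, δd j)
        ≤ Real.sqrt (E 0 - E J) * (Real.sqrt (ε / κ) * Real.sqrt (E 0 - E J)) :=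
          mul_le_mul_of_nonneg_left h4 (Real.sqrt_nonneg _)
      _ = Real.sqrt (ε / κ) * (Real.sqrt (E 0 - E J) * Real.sqrt (E 0 - E J)) := by ring
      _ = Real.sqrt (ε / κ) * (E 0 - E J) := by rw [Real.mul_self_sqrt hdrop]
  have h6 : |C J| ≤ A * (Real.sqrt (ε / κ) * (E 0 - E J)) + B * (E 0 - E J) :=
    h3.trans (by linarith [mul_le_mul_of_nonneg_left h5 hA])
  have h7 : C J ≤ A * (Real.sqrt (ε / κ) * (E 0 - E J)) + B * (E 0 - E J) := (le_abs_self _).trans h6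
  rw [hEu J]
  nlinarith

/-- Drop form: with `‖u_0‖² = E_0` (same datum), `(1 − (2A√(ε/κ) + 2B + ε))·drop_v ≤ drop_u` where `drop_v = E_0 − E_J`,
`drop_u = E_0 − ‖u_J‖²`. [folklore] -/
theorem drop_ge_of_R1_R2 (D C E Eu δd : ℕ → ℝ) {κ ε A B : ℝ} (hκ : 0 < κ) (hε : 0 ≤ ε) (hA : 0 ≤ A)
    (hD : ∀ j, 0 ≤ D j) (hD0 : D 0 = 0) (hC0 : C 0 = 0) (hE : ∀ j, E (j + 1) ≤ E j) (hδd : ∀ j, 0 ≤ δd j)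
    (hR1 : ∀ j, D (j + 1) ≤ D j - κ * δd j + ε * (E j - E (j + 1)))
    (hR2 : ∀ j, |C (j + 1) - C j| ≤ A * Real.sqrt ((E j - E (j + 1)) * δd j) + B * (E j - E (j + 1)))
    (hEu : ∀ j, Eu j = E j + 2 * C j + D j) (J : ℕ) :
    (1 - (2 * A * Real.sqrt (ε / κ) + 2 * B + ε)) * (E 0 - E J) ≤ E 0 - Eu J := by
  have h := energy_sub_le_of_R1_R2 D C E Eu δd hκ hε hA hD hD0 hC0 hE hδd hR1 hR2 hEu J
  nlinarith

/-! ## § 2. One window: the per-mode tracking law gives (R1) and (R2)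

Finite orthogonal decomposition (index set `s`): at the window start the effective field has mode amplitudes `y ℓ`, the difference `u − v` has
`x ℓ` (so `u` has `y ℓ + x ℓ`); the effective one-window propagator multiplies mode `ℓ` by `q ℓ ∈ [0,1]`; the true propagator applied to `u`'s
start datum returns `q ℓ (y ℓ + x ℓ) + e ℓ` with the DECAY-RELATIVE TRACKING ERROR `|e ℓ| ≤ ε₀ (1 − q ℓ) |y ℓ + x ℓ|`.  Window-end quantities:
`D' = Σ (q x + e)²`, `C' = Σ (q y)(q x + e)`; window-start `D = Σ x²`, `C = Σ y x`; drops `δᵛ = Σ (1 − q²) y²`, `δᵈ = Σ (1 − q²) x²`. -/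

/-- `q(1−q) ≤ (1 − q²)/2` and `(1−q)² ≤ 1 − q²` on `[0,1]`. [folklore] -/
theorem decay_weights_le {q : ℝ} (hq0 : 0 ≤ q) (hq1 : q ≤ 1) :
    q * (1 - q) ≤ (1 - q ^ 2) / 2 ∧ (1 - q) ^ 2 ≤ 1 - q ^ 2 := by
  constructor <;> nlinarith

/-- Weighted Cauchy–Schwarz: `Σ w |a| |b| ≤ √(Σ w a²) √(Σ w b²)` for `w ≥ 0`. [folklore] -/
theorem sum_weight_abs_mul_abs_le {ι : Type*} (s : Finset ι) (w a b : ι → ℝ) (hw : ∀ i ∈ s, 0 ≤ w i) :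
    ∑ i ∈ s, w i * |a i| * |b i| ≤ Real.sqrt (∑ i ∈ s, w i * a i ^ 2) * Real.sqrt (∑ i ∈ s, w i * b i ^ 2) := by
  have hcs := sum_mul_sq_le_sq_mul_sq s (fun i => Real.sqrt (w i) * |a i|) (fun i => Real.sqrt (w i) * |b i|)
  have e0 : ∑ i ∈ s, Real.sqrt (w i) * |a i| * (Real.sqrt (w i) * |b i|) = ∑ i ∈ s, w i * |a i| * |b i| := by
    refine sum_congr rfl fun i hi => ?_
    have : Real.sqrt (w i) * Real.sqrt (w i) = w i := Real.mul_self_sqrt (hw i hi)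
    calc Real.sqrt (w i) * |a i| * (Real.sqrt (w i) * |b i|) = (Real.sqrt (w i) * Real.sqrt (w i)) * |a i| * |b i| := by ring
      _ = w i * |a i| * |b i| := by rw [this]
  have e1 : ∑ i ∈ s, (Real.sqrt (w i) * |a i|) ^ 2 = ∑ i ∈ s, w i * a i ^ 2 := by
    refine sum_congr rfl fun i hi => ?_
    rw [mul_pow, Real.sq_sqrt (hw i hi), sq_abs]
  have e2 : ∑ i ∈ s, (Real.sqrt (w i) * |b i|) ^ 2 = ∑ i ∈ s, w i * b i ^ 2 := by
    refine sum_congr rfl fun i hi => ?_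
    rw [mul_pow, Real.sq_sqrt (hw i hi), sq_abs]
  rw [e0, e1, e2] at hcs
  have hL : 0 ≤ ∑ i ∈ s, w i * |a i| * |b i| := sum_nonneg fun i hi => by
    have := hw i hi; positivity
  have hX : 0 ≤ ∑ i ∈ s, w i * a i ^ 2 := sum_nonneg fun i hi => mul_nonneg (hw i hi) (sq_nonneg _)
  rw [← Real.sqrt_mul hX, ← Real.sqrt_sq hL]
  exact Real.sqrt_le_sqrt hcs

/-- **(R1) from the per-mode tracking law** (one window, finite orthogonal decomposition): with `|e ℓ| ≤ ε₀ (1 − q ℓ) |y ℓ + x ℓ|`,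
`q ℓ ∈ [0,1]`, `0 ≤ ε₀`:
`Σ (q x + e)² ≤ Σ x² − (1 − 2ε₀ − 2ε₀²)·Σ(1−q²)x² + (ε₀/2 + 2ε₀²)·Σ(1−q²)y²`. [folklore] -/
theorem R1_of_tracking {ι : Type*} (s : Finset ι) (q x y e : ι → ℝ) {ε₀ : ℝ} (hε₀ : 0 ≤ ε₀)
    (hq : ∀ ℓ ∈ s, 0 ≤ q ℓ ∧ q ℓ ≤ 1) (he : ∀ ℓ ∈ s, |e ℓ| ≤ ε₀ * (1 - q ℓ) * |y ℓ + x ℓ|) :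
    ∑ ℓ ∈ s, (q ℓ * x ℓ + e ℓ) ^ 2 ≤
      ∑ ℓ ∈ s, x ℓ ^ 2 - (1 - 2 * ε₀ - 2 * ε₀ ^ 2) * ∑ ℓ ∈ s, (1 - q ℓ ^ 2) * x ℓ ^ 2 +
        (ε₀ / 2 + 2 * ε₀ ^ 2) * ∑ ℓ ∈ s, (1 - q ℓ ^ 2) * y ℓ ^ 2 := by
  -- termwise: `(qx + e)² = q²x² + 2qxe + e²`, `|2qxe| ≤ 2ε₀ q(1−q)|x|(|y|+|x|)`, `e² ≤ 2ε₀²(1−q)²(y² + x²)`, and the weights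
  -- `q(1−q) ≤ (1−q²)/2`, `(1−q)² ≤ 1 − q²`
  have hterm : ∀ ℓ ∈ s, (q ℓ * x ℓ + e ℓ) ^ 2 ≤
      x ℓ ^ 2 - (1 - ε₀ - 2 * ε₀ ^ 2) * ((1 - q ℓ ^ 2) * x ℓ ^ 2) + (2 * ε₀ ^ 2) * ((1 - q ℓ ^ 2) * y ℓ ^ 2) +
        (2 * ε₀) * (q ℓ * (1 - q ℓ) * |x ℓ| * |y ℓ|) := by
    intro ℓ hℓ
    obtain ⟨hq0, hq1⟩ := hq ℓ hℓ
    obtain ⟨hw1, hw2⟩ := decay_weights_le hq0 hq1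
    have h1q : 0 ≤ 1 - q ℓ := by linarith
    have he' : |e ℓ| ≤ ε₀ * (1 - q ℓ) * (|y ℓ| + |x ℓ|) :=
      (he ℓ hℓ).trans (mul_le_mul_of_nonneg_left (abs_add_le _ _) (by positivity))
    -- cross term
    have hcross : 2 * (q ℓ * x ℓ) * e ℓ ≤ 2 * ε₀ * (q ℓ * (1 - q ℓ)) * x ℓ ^ 2 + 2 * ε₀ * ((q ℓ * (1 - q ℓ)) * |x ℓ| * |y ℓ|) := by
      have h1 : 2 * (q ℓ * x ℓ) * e ℓ ≤ 2 * (q ℓ * |x ℓ|) * |e ℓ| := by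
        have h := le_abs_self (x ℓ * e ℓ)
        rw [abs_mul] at h
        nlinarith
      have h2 : 2 * (q ℓ * |x ℓ|) * |e ℓ| ≤ 2 * (q ℓ * |x ℓ|) * (ε₀ * (1 - q ℓ) * (|y ℓ| + |x ℓ|)) :=
        mul_le_mul_of_nonneg_left he' (by positivity)
      have e3 : 2 * (q ℓ * |x ℓ|) * (ε₀ * (1 - q ℓ) * (|y ℓ| + |x ℓ|)) =
          2 * ε₀ * (q ℓ * (1 - q ℓ)) * (|x ℓ| * |x ℓ|) + 2 * ε₀ * ((q ℓ * (1 - q ℓ)) * |x ℓ| * |y ℓ|) := by ring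
      rw [e3, abs_mul_abs_self] at h2
      have e4 : x ℓ * x ℓ = x ℓ ^ 2 := by ring
      rw [e4] at h2
      exact h1.trans h2
    -- square term
    have hsq : e ℓ ^ 2 ≤ 2 * ε₀ ^ 2 * (1 - q ℓ) ^ 2 * (y ℓ ^ 2 + x ℓ ^ 2) := by
      have h1 : e ℓ ^ 2 ≤ (ε₀ * (1 - q ℓ) * (|y ℓ| + |x ℓ|)) ^ 2 := by
        rw [← sq_abs (e ℓ)]
        exact pow_le_pow_left₀ (abs_nonneg _) he' 2
      have h2 : (|y ℓ| + |x ℓ|) ^ 2 ≤ 2 * (y ℓ ^ 2 + x ℓ ^ 2) := by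
        rw [← sq_abs (y ℓ), ← sq_abs (x ℓ)]
        nlinarith [sq_nonneg (|y ℓ| - |x ℓ|)]
      calc e ℓ ^ 2 ≤ (ε₀ * (1 - q ℓ) * (|y ℓ| + |x ℓ|)) ^ 2 := h1
        _ = (ε₀ * (1 - q ℓ)) ^ 2 * (|y ℓ| + |x ℓ|) ^ 2 := by ring
        _ ≤ (ε₀ * (1 - q ℓ)) ^ 2 * (2 * (y ℓ ^ 2 + x ℓ ^ 2)) := mul_le_mul_of_nonneg_left h2 (sq_nonneg _)
        _ = 2 * ε₀ ^ 2 * (1 - q ℓ) ^ 2 * (y ℓ ^ 2 + x ℓ ^ 2) := by ring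
    have e5 : (q ℓ * x ℓ + e ℓ) ^ 2 = q ℓ ^ 2 * x ℓ ^ 2 + 2 * (q ℓ * x ℓ) * e ℓ + e ℓ ^ 2 := by ring
    rw [e5]
    have hx2 := sq_nonneg (x ℓ)
    have hy2 := sq_nonneg (y ℓ)
    nlinarith [mul_nonneg hε₀ hx2, mul_nonneg hε₀ hy2, mul_nonneg (sq_nonneg ε₀) hx2, mul_nonneg (sq_nonneg ε₀) hy2,
      mul_le_mul_of_nonneg_right hw1 (mul_nonneg hε₀ hx2), mul_le_mul_of_nonneg_right hw2 (mul_nonneg (sq_nonneg ε₀) hx2),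
      mul_le_mul_of_nonneg_right hw2 (mul_nonneg (sq_nonneg ε₀) hy2)]
  refine (sum_le_sum hterm).trans ?_
  rw [sum_add_distrib, sum_add_distrib, sum_sub_distrib, ← mul_sum, ← mul_sum, ← mul_sum]
  -- the mixed term by weighted Cauchy–Schwarz: `Σ q(1−q)|x||y| ≤ √(Σq(1−q)x²)√(Σq(1−q)y²) ≤ √(X/2)√(Y/2) ≤ (X + Y)/4`
  have hw : ∀ ℓ ∈ s, 0 ≤ q ℓ * (1 - q ℓ) := fun ℓ hℓ => mul_nonneg (hq ℓ hℓ).1 (by linarith [(hq ℓ hℓ).2])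
  have hmix := sum_weight_abs_mul_abs_le s (fun ℓ => q ℓ * (1 - q ℓ)) x y hw
  set X := ∑ ℓ ∈ s, (1 - q ℓ ^ 2) * x ℓ ^ 2 with hX
  set Y := ∑ ℓ ∈ s, (1 - q ℓ ^ 2) * y ℓ ^ 2 with hY
  have hA : ∑ ℓ ∈ s, q ℓ * (1 - q ℓ) * x ℓ ^ 2 ≤ X / 2 := by
    rw [le_div_iff₀ (by norm_num : (0:ℝ) < 2), sum_mul]
    exact sum_le_sum fun ℓ hℓ => by nlinarith [(decay_weights_le (hq ℓ hℓ).1 (hq ℓ hℓ).2).1, sq_nonneg (x ℓ)]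
  have hB : ∑ ℓ ∈ s, q ℓ * (1 - q ℓ) * y ℓ ^ 2 ≤ Y / 2 := by
    rw [le_div_iff₀ (by norm_num : (0:ℝ) < 2), sum_mul]
    exact sum_le_sum fun ℓ hℓ => by nlinarith [(decay_weights_le (hq ℓ hℓ).1 (hq ℓ hℓ).2).1, sq_nonneg (y ℓ)]
  have hX0 : 0 ≤ X := sum_nonneg fun ℓ hℓ => mul_nonneg (by nlinarith [(hq ℓ hℓ).1, (hq ℓ hℓ).2]) (sq_nonneg _)
  have hY0 : 0 ≤ Y := sum_nonneg fun ℓ hℓ => mul_nonneg (by nlinarith [(hq ℓ hℓ).1, (hq ℓ hℓ).2]) (sq_nonneg _)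
  have hmix' : ∑ ℓ ∈ s, q ℓ * (1 - q ℓ) * |x ℓ| * |y ℓ| ≤ (X + Y) / 4 := by
    have h1 : Real.sqrt (∑ ℓ ∈ s, q ℓ * (1 - q ℓ) * x ℓ ^ 2) ≤ Real.sqrt (X / 2) := Real.sqrt_le_sqrt hA
    have h2 : Real.sqrt (∑ ℓ ∈ s, q ℓ * (1 - q ℓ) * y ℓ ^ 2) ≤ Real.sqrt (Y / 2) := Real.sqrt_le_sqrt hB
    have h3 : Real.sqrt (X / 2) * Real.sqrt (Y / 2) ≤ (X + Y) / 4 := by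
      have := Real.sqrt_nonneg (X / 2)
      have := Real.sqrt_nonneg (Y / 2)
      nlinarith [sq_nonneg (Real.sqrt (X / 2) - Real.sqrt (Y / 2)), Real.sq_sqrt (by linarith : 0 ≤ X / 2),
        Real.sq_sqrt (by linarith : 0 ≤ Y / 2)]
    calc ∑ ℓ ∈ s, q ℓ * (1 - q ℓ) * |x ℓ| * |y ℓ| ≤ _ := hmix
      _ ≤ Real.sqrt (X / 2) * Real.sqrt (Y / 2) := mul_le_mul h1 h2 (Real.sqrt_nonneg _) (Real.sqrt_nonneg _)
      _ ≤ (X + Y) / 4 := h3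
  nlinarith [mul_nonneg hε₀ hX0, mul_nonneg hε₀ hY0]

/-- **(R2) from the per-mode tracking law**: `|Σ (q y)(q x + e) − Σ y x| ≤ (1 + ε₀/2)·√(Σ(1−q²)y²)·√(Σ(1−q²)x²) + (ε₀/2)·Σ(1−q²)y²`. [folklore] -/
theorem R2_of_tracking {ι : Type*} (s : Finset ι) (q x y e : ι → ℝ) {ε₀ : ℝ} (hε₀ : 0 ≤ ε₀)
    (hq : ∀ ℓ ∈ s, 0 ≤ q ℓ ∧ q ℓ ≤ 1) (he : ∀ ℓ ∈ s, |e ℓ| ≤ ε₀ * (1 - q ℓ) * |y ℓ + x ℓ|) :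
    |∑ ℓ ∈ s, (q ℓ * y ℓ) * (q ℓ * x ℓ + e ℓ) - ∑ ℓ ∈ s, y ℓ * x ℓ| ≤
      (1 + ε₀ / 2) * (Real.sqrt (∑ ℓ ∈ s, (1 - q ℓ ^ 2) * y ℓ ^ 2) * Real.sqrt (∑ ℓ ∈ s, (1 - q ℓ ^ 2) * x ℓ ^ 2)) +
        ε₀ / 2 * ∑ ℓ ∈ s, (1 - q ℓ ^ 2) * y ℓ ^ 2 := by
  set X := ∑ ℓ ∈ s, (1 - q ℓ ^ 2) * x ℓ ^ 2 with hX
  set Y := ∑ ℓ ∈ s, (1 - q ℓ ^ 2) * y ℓ ^ 2 with hY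
  -- `Σ (q y)(q x + e) − Σ y x = −Σ (1−q²) y x + Σ q y e`
  have e1 : ∑ ℓ ∈ s, (q ℓ * y ℓ) * (q ℓ * x ℓ + e ℓ) - ∑ ℓ ∈ s, y ℓ * x ℓ =
      -(∑ ℓ ∈ s, (1 - q ℓ ^ 2) * (y ℓ * x ℓ)) + ∑ ℓ ∈ s, q ℓ * y ℓ * e ℓ := by
    rw [← sum_neg_distrib, ← sum_add_distrib, ← sum_sub_distrib]
    refine sum_congr rfl fun ℓ _ => ?_
    ring
  rw [e1]
  -- first term by weighted Cauchy–Schwarz with weight `1 − q²`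
  have hw1 : ∀ ℓ ∈ s, 0 ≤ 1 - q ℓ ^ 2 := fun ℓ hℓ => by nlinarith [(hq ℓ hℓ).1, (hq ℓ hℓ).2]
  have hT1 : |∑ ℓ ∈ s, (1 - q ℓ ^ 2) * (y ℓ * x ℓ)| ≤ Real.sqrt Y * Real.sqrt X := by
    have h := sum_weight_abs_mul_abs_le s (fun ℓ => 1 - q ℓ ^ 2) y x hw1
    refine (abs_sum_le_sum_abs _ _).trans (le_trans (sum_le_sum fun ℓ hℓ => ?_) h)
    rw [abs_mul, abs_of_nonneg (hw1 ℓ hℓ), abs_mul, mul_assoc]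
  -- second term: `|Σ q y e| ≤ ε₀ Σ q(1−q)|y|(|y|+|x|) ≤ ε₀ (Y/2 + √(Y/2)√(X/2))`
  have hw2 : ∀ ℓ ∈ s, 0 ≤ q ℓ * (1 - q ℓ) := fun ℓ hℓ => mul_nonneg (hq ℓ hℓ).1 (by linarith [(hq ℓ hℓ).2])
  have hT2 : |∑ ℓ ∈ s, q ℓ * y ℓ * e ℓ| ≤ ε₀ * (Y / 2 + Real.sqrt Y * Real.sqrt X / 2) := by
    have h1 : |∑ ℓ ∈ s, q ℓ * y ℓ * e ℓ| ≤ ∑ ℓ ∈ s, ε₀ * (q ℓ * (1 - q ℓ) * y ℓ ^ 2 + q ℓ * (1 - q ℓ) * |y ℓ| * |x ℓ|) := by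
      refine (abs_sum_le_sum_abs _ _).trans (sum_le_sum fun ℓ hℓ => ?_)
      obtain ⟨hq0, hq1⟩ := hq ℓ hℓ
      have heℓ := (he ℓ hℓ).trans (mul_le_mul_of_nonneg_left (abs_add_le _ _) (by nlinarith))
      rw [abs_mul, abs_mul, abs_of_nonneg hq0]
      have hy0 := abs_nonneg (y ℓ)
      calc q ℓ * |y ℓ| * |e ℓ| ≤ q ℓ * |y ℓ| * (ε₀ * (1 - q ℓ) * (|y ℓ| + |x ℓ|)) :=
            mul_le_mul_of_nonneg_left heℓ (by positivity)
        _ = ε₀ * (q ℓ * (1 - q ℓ) * (|y ℓ| * |y ℓ|) + q ℓ * (1 - q ℓ) * |y ℓ| * |x ℓ|) := by ring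
        _ = ε₀ * (q ℓ * (1 - q ℓ) * y ℓ ^ 2 + q ℓ * (1 - q ℓ) * |y ℓ| * |x ℓ|) := by rw [abs_mul_abs_self]; ring
    have hA : ∑ ℓ ∈ s, q ℓ * (1 - q ℓ) * y ℓ ^ 2 ≤ Y / 2 := by
      rw [le_div_iff₀ (by norm_num : (0:ℝ) < 2), sum_mul]
      exact sum_le_sum fun ℓ hℓ => by nlinarith [(decay_weights_le (hq ℓ hℓ).1 (hq ℓ hℓ).2).1, sq_nonneg (y ℓ)]
    have hBx : ∑ ℓ ∈ s, q ℓ * (1 - q ℓ) * x ℓ ^ 2 ≤ X / 2 := by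
      rw [le_div_iff₀ (by norm_num : (0:ℝ) < 2), sum_mul]
      exact sum_le_sum fun ℓ hℓ => by nlinarith [(decay_weights_le (hq ℓ hℓ).1 (hq ℓ hℓ).2).1, sq_nonneg (x ℓ)]
    have hmix := sum_weight_abs_mul_abs_le s (fun ℓ => q ℓ * (1 - q ℓ)) y x hw2
    have hY0 : 0 ≤ Y := sum_nonneg fun ℓ hℓ => mul_nonneg (hw1 ℓ hℓ) (sq_nonneg _)
    have hX0 : 0 ≤ X := sum_nonneg fun ℓ hℓ => mul_nonneg (hw1 ℓ hℓ) (sq_nonneg _)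
    have hmix' : ∑ ℓ ∈ s, q ℓ * (1 - q ℓ) * |y ℓ| * |x ℓ| ≤ Real.sqrt Y * Real.sqrt X / 2 := by
      have h1 := Real.sqrt_le_sqrt hA
      have h2 := Real.sqrt_le_sqrt hBx
      have e2 : Real.sqrt (Y / 2) * Real.sqrt (X / 2) = Real.sqrt Y * Real.sqrt X / 2 := by
        rw [Real.sqrt_div' Y zero_le_two, Real.sqrt_div' X zero_le_two, div_mul_div_comm,
          Real.mul_self_sqrt zero_le_two]
      calc ∑ ℓ ∈ s, q ℓ * (1 - q ℓ) * |y ℓ| * |x ℓ| ≤ _ := hmix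
        _ ≤ Real.sqrt (Y / 2) * Real.sqrt (X / 2) := mul_le_mul h1 h2 (Real.sqrt_nonneg _) (Real.sqrt_nonneg _)
        _ = Real.sqrt Y * Real.sqrt X / 2 := e2
    calc |∑ ℓ ∈ s, q ℓ * y ℓ * e ℓ| ≤ ∑ ℓ ∈ s, ε₀ * (q ℓ * (1 - q ℓ) * y ℓ ^ 2 + q ℓ * (1 - q ℓ) * |y ℓ| * |x ℓ|) := h1
      _ = ε₀ * (∑ ℓ ∈ s, q ℓ * (1 - q ℓ) * y ℓ ^ 2 + ∑ ℓ ∈ s, q ℓ * (1 - q ℓ) * |y ℓ| * |x ℓ|) := by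
          rw [← mul_sum, sum_add_distrib]
      _ ≤ ε₀ * (Y / 2 + Real.sqrt Y * Real.sqrt X / 2) := mul_le_mul_of_nonneg_left (add_le_add hA hmix') hε₀
  calc |-(∑ ℓ ∈ s, (1 - q ℓ ^ 2) * (y ℓ * x ℓ)) + ∑ ℓ ∈ s, q ℓ * y ℓ * e ℓ|
      ≤ |-(∑ ℓ ∈ s, (1 - q ℓ ^ 2) * (y ℓ * x ℓ))| + |∑ ℓ ∈ s, q ℓ * y ℓ * e ℓ| := abs_add_le _ _
    _ ≤ Real.sqrt Y * Real.sqrt X + ε₀ * (Y / 2 + Real.sqrt Y * Real.sqrt X / 2) := by rw [abs_neg]; exact add_le_add hT1 hT2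
    _ = (1 + ε₀ / 2) * (Real.sqrt Y * Real.sqrt X) + ε₀ / 2 * Y := by ring

end Summit.AnomalousDissipation.AnomalousDissipation.Theorems.SolenoidalFractalHomogenisation.LagrangianStep

end
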